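import Summits.Ventures.YMGap.FlowData.RectTubeGaugeInvariance
import Summits.Ventures.YMGap.FlowData.RectTubeFluxSectors
import Summits.Ventures.YMGap.FlowData.TubeOddSymmetrization
import HarnessLib

/-!
# Venture YMGap, track Y3 FLOW-DATA — inside a flux sector of a RECTANGULAR tube `T` only sees JOINTLY ODD
# functions: the Gauss law spreads the twist `σ_{μ,0}` to every hyperplane flip `σ_{μ,s}`, `s ∈ ℤ/(Ls μ)` (theorems only)

HONEST FRAMING: venture file of the cell `pub-ymgap` (QuantumFields programme), track Y3; the v2 (rectangular,
`FlowData/RectTubeTransferOperator.lean`) twin of `FlowData/TubeOddSymmetrization.lean`, a brick of the rectangular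
strong-coupling window.  Finite spatial torus `Π_i ℤ/(Ls i)`; no number, no row, nothing about limits, the continuum
or a mass gap.  General compact group `G`, central involution `z` (`z² = 1`), any flux `e ∈ ℤ₂^k`.

Objects (written out, no new definition): the HYPERPLANE FLIP `σ_{μ,s} b = (e ↦ z^{[e.2 = μ ∧ e.1 μ = s]} b_e)`
(`σ_{μ,0} = rectFluxTwist z ê_μ`); the LAYER gauge transformation `η_{μ,t}(x) = z^{[x_μ = t]}` acting by the written-out
gauge action `b ↦ (e ↦ η(x) b_e η(x + ê_{e.2})⁻¹)` of `RectTubeTransferPositivity`, equal to `σ_{μ,t} ∘ σ_{μ,t−1}`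
(`rectGauge_layer`).  Since `T ∘ G_η = T` (`RectTubeGaugeInvariance`), averaging a sector vector over the commuting
involutive layers keeps `T g`, does not increase `‖g‖`, keeps the oddness under every `σ_{μ',0}` with `e_{μ'} = 1`, and
the fully averaged vector is odd under every `σ_{μ,s}`: **`exists_jointlyOdd_of_rectFluxProjection`** (`T g = T (P_e ψ)`,
`‖g‖ ≤ ‖ψ‖`, `g ∘ σ_{μ,s} = −g` a.e. for every `μ` with `e_μ = 1`, every `s ∈ ℤ/(Ls μ)`); `…_single` the axial case.

References: G. 't Hooft, Nucl. Phys. B 153 (1979) 141 [cite: tHooft1979Flux]; M. Lüscher, Commun. Math. Phys. 54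
(1977) 283 [cite: Luscher1977].
-/

noncomputable section

open scoped BigOperators ENNReal
open MeasureTheory Filter Function
open Literature.MathematicalPhysics.QuantumFieldTheory Literature.Analysis.OperatorTheory
open Literature.MathematicalPhysics.QuantumLattice (RectTorusSite)

namespace Summit.Ventures.YMGap.FlowData

section Config

variable {G : Type*} [Group G] {k : ℕ} {Ls : Fin k → ℕ} {z : G}

/-- The axial twist of the rectangular slice is the hyperplane flip at `x_μ = 0`:
`rectFluxTwist z ê_μ b = σ_{μ,0} b`. [cite: tHooft1979Flux] -/
theorem rectFluxTwist_single_eq_hyperplaneFlip (z : G) (μ : Fin k) (b : RectSlice Ls G) :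
    rectFluxTwist z (Pi.single μ 1) b = fun e => (if e.2 = μ ∧ e.1 μ = 0 then z else 1) * b e := by
  funext e
  rw [rectFluxTwist_apply]
  unfold rectFluxTwistPrefactor
  congr 1
  by_cases h : e.2 = μ
  · subst h
    simp only [Pi.single_eq_same, true_and]
  · have h0 : (Pi.single μ (1 : ZMod 2) : Fin k → ZMod 2) e.2 = 0 := by
      rw [Pi.single_apply, if_neg h]
    simp only [h0, zero_ne_one, false_and, if_false, h]

/-- **The layer gauge transformation is a product of two consecutive flips** (link by link): with
`η_t(x) = z^{[x_μ = t]}`, `η_t(x) · g · η_t(x + ê_i)⁻¹ = z^{[i = μ ∧ x_μ = t]} (z^{[i = μ ∧ x_μ = t−1]} g)` for the link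
`(x, i)` carrying the group element `g`. [cite: tHooft1979Flux] -/
theorem rectGauge_layer_pt (hz : z ∈ Subgroup.center G) (hzz : z * z = 1) (μ : Fin k) (t : ZMod (Ls μ))
    (e : RectTorusSite Ls × Fin k) (g : G) :
    (if e.1 μ = t then z else 1) * g * (if (e.1 + Pi.single e.2 1 : RectTorusSite Ls) μ = t then z else 1)⁻¹ =
      (if e.2 = μ ∧ e.1 μ = t then z else 1) * ((if e.2 = μ ∧ e.1 μ = t - 1 then z else 1) * g) := by
  have hzinv : z⁻¹ = z := inv_eq_of_mul_eq_one_right hzz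
  obtain ⟨x, i⟩ := e
  by_cases hi : i = μ
  · rw [hi]
    have hval : (x + Pi.single μ 1 : RectTorusSite Ls) μ = x μ + 1 := by
      simp only [Pi.add_apply, Pi.single_eq_same]
    have hiff : (x + Pi.single μ 1 : RectTorusSite Ls) μ = t ↔ x μ = t - 1 := by
      rw [hval]
      constructor
      · intro h; rw [← h, add_sub_cancel_right]
      · intro h; rw [h, sub_add_cancel]
    simp only [true_and]
    by_cases h1 : x μ = t - 1
    · rw [if_pos (hiff.2 h1), if_pos h1, hzinv, mul_assoc, Subgroup.mem_center_iff.1 hz g]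
    · rw [if_neg (fun h => h1 (hiff.1 h)), if_neg h1, inv_one, mul_one, one_mul]
  · have hval : (x + Pi.single i 1 : RectTorusSite Ls) μ = x μ := by
      rw [Pi.add_apply, Pi.single_eq_of_ne (fun h => hi h.symm), add_zero]
    have hne : ¬(i = μ ∧ x μ = t) := fun h => hi h.1
    have hne' : ¬(i = μ ∧ x μ = t - 1) := fun h => hi h.1
    rw [if_neg hne, if_neg hne', one_mul, one_mul]
    by_cases h1 : x μ = t
    · have h1' : (x + Pi.single i 1 : RectTorusSite Ls) μ = t := by rw [hval]; exact h1
      rw [if_pos h1, if_pos h1', hzinv, mul_assoc, Subgroup.mem_center_iff.1 hz g, ← mul_assoc, hzz, one_mul]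
    · have h1' : ¬(x + Pi.single i 1 : RectTorusSite Ls) μ = t := by rw [hval]; exact h1
      rw [if_neg h1, if_neg h1', inv_one, mul_one, one_mul]

/-- The layer gauge transformation of a configuration: `(e ↦ η_t(x) b_e η_t(x + ê_{e.2})⁻¹) = σ_t (σ_{t−1} b)`.
[cite: tHooft1979Flux] -/
theorem rectGauge_layer (hz : z ∈ Subgroup.center G) (hzz : z * z = 1) (μ : Fin k) (t : ZMod (Ls μ))
    (b : RectSlice Ls G) :
    (fun e : RectTorusSite Ls × Fin k =>
        (if e.1 μ = t then z else 1) * b e * (if (e.1 + Pi.single e.2 1 : RectTorusSite Ls) μ = t then z else 1)⁻¹) =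
      fun e => (if e.2 = μ ∧ e.1 μ = t then z else 1) *
        ((if e.2 = μ ∧ e.1 μ = t - 1 then z else 1) * b e) :=
  funext fun e => rectGauge_layer_pt hz hzz μ t e (b e)

/-- `η_t · (σ_{t−1} b) = σ_t b`. [folklore] -/
theorem rectGauge_layer_hyperplaneFlip (hz : z ∈ Subgroup.center G) (hzz : z * z = 1) (μ : Fin k)
    (t : ZMod (Ls μ)) (b : RectSlice Ls G) :
    (fun e : RectTorusSite Ls × Fin k =>
        (if e.1 μ = t then z else 1) * ((if e.2 = μ ∧ e.1 μ = t - 1 then z else 1) * b e) *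
          (if (e.1 + Pi.single e.2 1 : RectTorusSite Ls) μ = t then z else 1)⁻¹) =
      fun e => (if e.2 = μ ∧ e.1 μ = t then z else 1) * b e := by
  funext e
  rw [rectGauge_layer_pt hz hzz μ t e, flipFactor_cancel hzz]

/-- The layer gauge transformations are involutions on configurations. [folklore] -/
theorem rectGauge_layer_layer (hz : z ∈ Subgroup.center G) (hzz : z * z = 1) (μ : Fin k) (t : ZMod (Ls μ))
    (b : RectSlice Ls G) :
    (fun e : RectTorusSite Ls × Fin k =>
        (if e.1 μ = t then z else 1) *
            ((if e.1 μ = t then z else 1) * b e * (if (e.1 + Pi.single e.2 1 : RectTorusSite Ls) μ = t then z else 1)⁻¹) *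
          (if (e.1 + Pi.single e.2 1 : RectTorusSite Ls) μ = t then z else 1)⁻¹) = b := by
  funext e
  rw [rectGauge_layer_pt hz hzz μ t e (b e), rectGauge_layer_pt hz hzz μ t e,
    flipFactor_left_comm hz _ _ (b e), flipFactor_cancel hzz, flipFactor_cancel hzz]

/-- The layer gauge transformations (any two directions, any two layers) commute with each other. [folklore] -/
theorem rectGauge_layer_comm (hz : z ∈ Subgroup.center G) (hzz : z * z = 1) (μ μ' : Fin k) (t : ZMod (Ls μ))
    (t' : ZMod (Ls μ')) (b : RectSlice Ls G) :
    (fun e : RectTorusSite Ls × Fin k =>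
        (if e.1 μ = t then z else 1) *
            ((if e.1 μ' = t' then z else 1) * b e *
              (if (e.1 + Pi.single e.2 1 : RectTorusSite Ls) μ' = t' then z else 1)⁻¹) *
          (if (e.1 + Pi.single e.2 1 : RectTorusSite Ls) μ = t then z else 1)⁻¹) =
      fun e : RectTorusSite Ls × Fin k =>
        (if e.1 μ' = t' then z else 1) *
            ((if e.1 μ = t then z else 1) * b e *
              (if (e.1 + Pi.single e.2 1 : RectTorusSite Ls) μ = t then z else 1)⁻¹) *
          (if (e.1 + Pi.single e.2 1 : RectTorusSite Ls) μ' = t' then z else 1)⁻¹ := by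
  funext e
  rw [rectGauge_layer_pt hz hzz μ' t' e (b e), rectGauge_layer_pt hz hzz μ t e (b e),
    rectGauge_layer_pt hz hzz μ t e, rectGauge_layer_pt hz hzz μ' t' e]
  rw [flipFactor_left_comm hz _ _ ((if e.2 = μ' ∧ e.1 μ' = t' - 1 then z else 1) * b e),
    flipFactor_left_comm hz _ _ ((if e.2 = μ ∧ e.1 μ = t - 1 then z else 1) *
      ((if e.2 = μ' ∧ e.1 μ' = t' - 1 then z else 1) * b e)),
    flipFactor_left_comm hz _ _ (b e),
    flipFactor_left_comm hz _ _ ((if e.2 = μ ∧ e.1 μ = t - 1 then z else 1) * b e)]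

/-- The layer gauge transformations commute with every hyperplane flip (any direction, any hyperplane). [folklore] -/
theorem rectGauge_layer_hyperplaneFlip_comm (hz : z ∈ Subgroup.center G) (hzz : z * z = 1) (μ μ' : Fin k)
    (t : ZMod (Ls μ)) (s' : ZMod (Ls μ')) (b : RectSlice Ls G) :
    (fun e : RectTorusSite Ls × Fin k =>
        (if e.1 μ = t then z else 1) * ((if e.2 = μ' ∧ e.1 μ' = s' then z else 1) * b e) *
          (if (e.1 + Pi.single e.2 1 : RectTorusSite Ls) μ = t then z else 1)⁻¹) =
      fun e => (if e.2 = μ' ∧ e.1 μ' = s' then z else 1) *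
        ((if e.1 μ = t then z else 1) * b e *
          (if (e.1 + Pi.single e.2 1 : RectTorusSite Ls) μ = t then z else 1)⁻¹) := by
  funext e
  rw [rectGauge_layer_pt hz hzz μ t e, rectGauge_layer_pt hz hzz μ t e,
    flipFactor_left_comm hz _ _ (b e),
    flipFactor_left_comm hz _ _ ((if e.2 = μ ∧ e.1 μ = t - 1 then z else 1) * b e)]

variable [∀ i, NeZero (Ls i)]

/-- **Spatial plaquettes are blind to every hyperplane flip** of the rectangular slice: `magSum (σ_s b) = magSum b`
for all `s ∈ ℤ/(Ls μ)` (`σ_0` is the tree's twist, `rectMagSum_fluxTwist`; `σ_t = η_t · σ_{t−1}` and `magSum` is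
gauge invariant, `rectMagSum_gauge`). [cite: tHooft1979Flux] -/
theorem rectMagSum_hyperplaneFlip {n : ℕ} (ρ : G →* Matrix (Fin n) (Fin n) ℂ) (hz : z ∈ Subgroup.center G)
    (hzz : z * z = 1) (μ : Fin k) (s : ZMod (Ls μ)) (b : RectSlice Ls G) :
    rectMagSum (Ls := Ls) ρ (fun e => (if e.2 = μ ∧ e.1 μ = s then z else 1) * b e) =
      rectMagSum (Ls := Ls) ρ b := by
  have key : ∀ j : ℕ, ∀ b : RectSlice Ls G,
      rectMagSum (Ls := Ls) ρ (fun e => (if e.2 = μ ∧ e.1 μ = (j : ZMod (Ls μ)) then z else 1) * b e) =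
        rectMagSum (Ls := Ls) ρ b := by
    intro j
    induction j with
    | zero =>
      intro b
      rw [Nat.cast_zero, ← rectFluxTwist_single_eq_hyperplaneFlip z μ b, rectMagSum_fluxTwist ρ hz]
    | succ j ih =>
      intro b
      have htj : ((j + 1 : ℕ) : ZMod (Ls μ)) - 1 = (j : ZMod (Ls μ)) := by rw [Nat.cast_succ, add_sub_cancel_right]
      rw [← rectGauge_layer_hyperplaneFlip hz hzz μ ((j + 1 : ℕ) : ZMod (Ls μ)) b,
        rectMagSum_gauge (Ls := Ls) ρ (fun x : RectTorusSite Ls => if x μ = ((j + 1 : ℕ) : ZMod (Ls μ)) then z else 1),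
        htj, ih]
  have hs : s = ((s.val : ℕ) : ZMod (Ls μ)) := (ZMod.natCast_zmod_val s).symm
  rw [hs]
  exact key s.val b

end Config

section Measure

variable {G : Type*} [Group G] [TopologicalSpace G] [IsTopologicalGroup G] [CompactSpace G]
  [MeasurableSpace G] [BorelSpace G] {k : ℕ} {Ls : Fin k → ℕ} [∀ i, NeZero (Ls i)]

/-- A hyperplane flip preserves the rectangular slice measure (left translation link by link). [folklore] -/
theorem measurePreserving_rectHyperplaneFlip (z : G) (μ : Fin k) (s : ZMod (Ls μ)) :
    MeasurePreserving
      (fun (b : RectSlice Ls G) (e : RectTorusSite Ls × Fin k) => (if e.2 = μ ∧ e.1 μ = s then z else 1) * b e)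
      (rectSliceMeasure G Ls) (rectSliceMeasure G Ls) :=
  measurePreserving_pi (f := fun (e : RectTorusSite Ls × Fin k) (x : G) => (if e.2 = μ ∧ e.1 μ = s then z else 1) * x)
    (fun _ : RectTorusSite Ls × Fin k => haarProbability G) (fun _ : RectTorusSite Ls × Fin k => haarProbability G)
    fun _ => measurePreserving_mul_left (haarProbability G) _

end Measure

section Symmetrization

variable {G : Type*} [Group G] [TopologicalSpace G] [IsTopologicalGroup G] [CompactSpace G]
  [MeasurableSpace G] [BorelSpace G] [SecondCountableTopology G] {n : ℕ} (ρ : G →* Matrix (Fin n) (Fin n) ℂ)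
  (J : ℝ) {k : ℕ} {Ls : Fin k → ℕ} [∀ i, NeZero (Ls i)]

omit [SecondCountableTopology G] in
/-- **A vector of the flux sector `e` is odd under the axial twist of every direction in the support of `e`**
(rectangular slice): `(P_e ψ) ∘ σ_{μ,0} = −P_e ψ` a.e. whenever `e_μ = 1`. [cite: tHooft1979Flux] -/
theorem rectFluxProjection_odd_ae {z : G} (hzz : z * z = 1) (e : Fin k → ZMod 2) {μ : Fin k} (hμ : e μ = 1)
    (ψ : Lp ℝ 2 (rectSliceMeasure G Ls)) :
    ∀ᵐ b ∂(rectSliceMeasure G Ls),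
      (rectTubeFluxProjection z Ls e ψ : RectSlice Ls G → ℝ)
          (fun e' => (if e'.2 = μ ∧ e'.1 μ = 0 then z else 1) * b e') =
        -(rectTubeFluxProjection z Ls e ψ : RectSlice Ls G → ℝ) b := by
  set g := rectTubeFluxProjection z Ls e ψ with hg
  have hop : rectFluxTwistOp Ls z (Pi.single μ 1) g = -g := by
    have h := congrArg (fun A => A ψ) (rectFluxTwistOp_comp_rectTubeFluxProjection (Ls := Ls) z hzz
      e (Pi.single μ 1))
    simp only [ContinuousLinearMap.comp_apply, fluxSign_single_of_eq_one hμ, neg_one_smul] at h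
    exact h
  have h1 := rectFluxTwistOp_ae_eq (Ls := Ls) z (Pi.single μ 1) g
  rw [hop] at h1
  filter_upwards [h1, Lp.coeFn_neg g] with b hb1 hb2
  rw [hb2, Pi.neg_apply, comp_apply, rectFluxTwist_single_eq_hyperplaneFlip] at hb1
  exact hb1.symm

/-- **One symmetrisation step** (rectangular slice).  Given `g` odd under `σ_{μ',0}` for every direction `μ' ∈ D`,
invariant under the layers in `S`, with `T g = T g₀` and `‖g‖ ≤ ‖ψ‖`, the vector `g' = ½(g + G_{η_{μ,t}} g)` has the
same properties and is moreover `η_{μ,t}`-invariant. [cite: Luscher1977] -/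
theorem rect_symmetrization_step (hρ : Continuous ρ) {z : G} (hz : z ∈ Subgroup.center G) (hzz : z * z = 1)
    (D : Finset (Fin k)) (μ : Fin k) (t : ZMod (Ls μ)) (S : Finset ((ν : Fin k) × ZMod (Ls ν)))
    (g₀ ψ g : Lp ℝ 2 (rectSliceMeasure G Ls))
    (hodd : ∀ μ' ∈ D, ∀ᵐ b ∂(rectSliceMeasure G Ls),
      (g : RectSlice Ls G → ℝ) (fun e => (if e.2 = μ' ∧ e.1 μ' = 0 then z else 1) * b e) =
        -(g : RectSlice Ls G → ℝ) b)
    (hinv : ∀ p ∈ S, ∀ᵐ b ∂(rectSliceMeasure G Ls),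
      (g : RectSlice Ls G → ℝ) (fun e => (if e.1 p.1 = p.2 then z else 1) * b e *
          (if (e.1 + Pi.single e.2 1 : RectTorusSite Ls) p.1 = p.2 then z else 1)⁻¹) =
        (g : RectSlice Ls G → ℝ) b)
    (hT : rectTubeTransferOperator ρ J Ls g = rectTubeTransferOperator ρ J Ls g₀) (hnorm : ‖g‖ ≤ ‖ψ‖) :
    ∃ g' : Lp ℝ 2 (rectSliceMeasure G Ls),
      (∀ μ' ∈ D, ∀ᵐ b ∂(rectSliceMeasure G Ls),
        (g' : RectSlice Ls G → ℝ) (fun e => (if e.2 = μ' ∧ e.1 μ' = 0 then z else 1) * b e) =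
          -(g' : RectSlice Ls G → ℝ) b) ∧
      (∀ p ∈ insert (⟨μ, t⟩ : (ν : Fin k) × ZMod (Ls ν)) S, ∀ᵐ b ∂(rectSliceMeasure G Ls),
        (g' : RectSlice Ls G → ℝ) (fun e => (if e.1 p.1 = p.2 then z else 1) * b e *
            (if (e.1 + Pi.single e.2 1 : RectTorusSite Ls) p.1 = p.2 then z else 1)⁻¹) =
          (g' : RectSlice Ls G → ℝ) b) ∧
      rectTubeTransferOperator ρ J Ls g' = rectTubeTransferOperator ρ J Ls g₀ ∧ ‖g'‖ ≤ ‖ψ‖ := by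
  have hmp : MeasurePreserving
      (fun (b : RectSlice Ls G) (e : RectTorusSite Ls × Fin k) =>
        (if e.1 μ = t then z else 1) * b e * (if (e.1 + Pi.single e.2 1 : RectTorusSite Ls) μ = t then z else 1)⁻¹)
      (rectSliceMeasure G Ls) (rectSliceMeasure G Ls) :=
    measurePreserving_rectGauge (Ls := Ls) (fun x : RectTorusSite Ls => if x μ = t then z else 1)
  set Gt : Lp ℝ 2 (rectSliceMeasure G Ls) →L[ℝ] Lp ℝ 2 (rectSliceMeasure G Ls) :=
    (Lp.compMeasurePreservingₗᵢ ℝ _ hmp).toContinuousLinearMap with hGt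
  set g' : Lp ℝ 2 (rectSliceMeasure G Ls) := (1 / 2 : ℝ) • (g + Gt g) with hg'
  have hGt_ae : ((Gt g : Lp ℝ 2 (rectSliceMeasure G Ls)) : RectSlice Ls G → ℝ) =ᵐ[rectSliceMeasure G Ls]
      (g : RectSlice Ls G → ℝ) ∘
        (fun (b : RectSlice Ls G) (e : RectTorusSite Ls × Fin k) =>
          (if e.1 μ = t then z else 1) * b e * (if (e.1 + Pi.single e.2 1 : RectTorusSite Ls) μ = t then z else 1)⁻¹) :=
    Lp.coeFn_compMeasurePreserving g hmp
  -- the a.e. formula for `g'`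
  have hg'_ae : ∀ᵐ b ∂(rectSliceMeasure G Ls), (g' : RectSlice Ls G → ℝ) b =
      (1 / 2 : ℝ) * ((g : RectSlice Ls G → ℝ) b + (g : RectSlice Ls G → ℝ)
        (fun e => (if e.1 μ = t then z else 1) * b e * (if (e.1 + Pi.single e.2 1 : RectTorusSite Ls) μ = t then z else 1)⁻¹)) := by
    filter_upwards [Lp.coeFn_smul (1 / 2 : ℝ) (g + Gt g), Lp.coeFn_add g (Gt g), hGt_ae] with b hb1 hb2 hb3
    rw [hg', hb1, Pi.smul_apply, hb2, Pi.add_apply, hb3, comp_apply, smul_eq_mul]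
  refine ⟨g', ?_, ?_, ?_, ?_⟩
  · -- oddness under `σ_{μ',0}` for `μ' ∈ D`
    intro μ' hμ'
    have hflip_mp : MeasurePreserving
        (fun (b : RectSlice Ls G) (e : RectTorusSite Ls × Fin k) => (if e.2 = μ' ∧ e.1 μ' = 0 then z else 1) * b e)
        (rectSliceMeasure G Ls) (rectSliceMeasure G Ls) :=
      measurePreserving_rectHyperplaneFlip z μ' 0
    have h1 := hflip_mp.quasiMeasurePreserving.ae hg'_ae
    have h2 := hmp.quasiMeasurePreserving.ae (hodd μ' hμ')
    filter_upwards [hg'_ae, h1, hodd μ' hμ', h2] with b hb hb1 hb2 hb3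
    rw [hb1, hb, rectGauge_layer_hyperplaneFlip_comm hz hzz μ μ' t 0 b, hb2, hb3]
    ring
  · -- invariance under the layers in `insert ⟨μ, t⟩ S`
    intro p hp
    rcases Finset.mem_insert.1 hp with hpt | hpS
    · subst hpt
      have h1 := hmp.quasiMeasurePreserving.ae hg'_ae
      filter_upwards [hg'_ae, h1] with b hb hb1
      rw [hb1, hb, rectGauge_layer_layer hz hzz μ t b]
      ring
    · have hmp' : MeasurePreserving
          (fun (b : RectSlice Ls G) (e : RectTorusSite Ls × Fin k) =>
            (if e.1 p.1 = p.2 then z else 1) * b e * (if (e.1 + Pi.single e.2 1 : RectTorusSite Ls) p.1 = p.2 then z else 1)⁻¹)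
          (rectSliceMeasure G Ls) (rectSliceMeasure G Ls) :=
        measurePreserving_rectGauge (Ls := Ls) (fun x : RectTorusSite Ls => if x p.1 = p.2 then z else 1)
      have h1 := hmp'.quasiMeasurePreserving.ae hg'_ae
      have h2 := hmp.quasiMeasurePreserving.ae (hinv p hpS)
      filter_upwards [hg'_ae, h1, hinv p hpS, h2] with b hb hb1 hb2 hb3
      rw [hb1, hb, hb2, rectGauge_layer_comm hz hzz μ p.1 t p.2 b, hb3]
  · -- `T g' = T g₀`
    have hTG : rectTubeTransferOperator ρ J Ls (Gt g) = rectTubeTransferOperator ρ J Ls g := by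
      have h := congrArg (fun A => A g)
        (rectTubeTransferOperator_comp_gaugeOp (Ls := Ls) ρ J hρ (fun x : RectTorusSite Ls => if x μ = t then z else 1))
      simpa only [ContinuousLinearMap.comp_apply] using h
    rw [hg', map_smul, map_add, hTG, hT, ← two_smul ℝ, smul_smul]
    norm_num
  · -- `‖g'‖ ≤ ‖ψ‖`
    have hGn : ‖Gt g‖ = ‖g‖ := Lp.norm_compMeasurePreserving g hmp
    calc ‖g'‖ = (1 / 2 : ℝ) * ‖g + Gt g‖ := by
          rw [hg', norm_smul, Real.norm_of_nonneg (by norm_num : (0 : ℝ) ≤ 1 / 2)]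
      _ ≤ (1 / 2 : ℝ) * (‖g‖ + ‖Gt g‖) := mul_le_mul_of_nonneg_left (norm_add_le _ _) (by norm_num)
      _ = ‖g‖ := by rw [hGn]; ring
      _ ≤ ‖ψ‖ := hnorm

/-- **Symmetrisation over any finite set of layers** (rectangular slice), keeping the oddness under `σ_{μ',0}` for
every `μ'` with `e_{μ'} = 1`. [folklore] -/
theorem exists_rectSymmetrized (hρ : Continuous ρ) {z : G} (hz : z ∈ Subgroup.center G) (hzz : z * z = 1)
    (e : Fin k → ZMod 2) (ψ : Lp ℝ 2 (rectSliceMeasure G Ls)) (S : Finset ((ν : Fin k) × ZMod (Ls ν))) :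
    ∃ g : Lp ℝ 2 (rectSliceMeasure G Ls),
      (∀ μ' ∈ Finset.univ.filter (fun μ' : Fin k => e μ' = 1), ∀ᵐ b ∂(rectSliceMeasure G Ls),
        (g : RectSlice Ls G → ℝ) (fun e' => (if e'.2 = μ' ∧ e'.1 μ' = 0 then z else 1) * b e') =
          -(g : RectSlice Ls G → ℝ) b) ∧
      (∀ p ∈ S, ∀ᵐ b ∂(rectSliceMeasure G Ls),
        (g : RectSlice Ls G → ℝ) (fun e' => (if e'.1 p.1 = p.2 then z else 1) * b e' *
            (if (e'.1 + Pi.single e'.2 1 : RectTorusSite Ls) p.1 = p.2 then z else 1)⁻¹) =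
          (g : RectSlice Ls G → ℝ) b) ∧
      rectTubeTransferOperator ρ J Ls g = rectTubeTransferOperator ρ J Ls (rectTubeFluxProjection z Ls e ψ) ∧
      ‖g‖ ≤ ‖ψ‖ := by
  classical
  induction S using Finset.induction_on with
  | empty =>
    refine ⟨rectTubeFluxProjection z Ls e ψ, fun μ' hμ' => ?_, fun p hp => absurd hp (Finset.notMem_empty p), rfl, ?_⟩
    · exact rectFluxProjection_odd_ae hzz e (Finset.mem_filter.1 hμ').2 ψ
    · have hP : ‖rectTubeFluxProjection z Ls e‖ ≤ 1 :=
        norm_fluxProjection_le_one (fun s => norm_rectFluxTwistOp_le_one (Ls := Ls) z s) e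
      calc ‖rectTubeFluxProjection z Ls e ψ‖ ≤ ‖rectTubeFluxProjection z Ls e‖ * ‖ψ‖ :=
            ContinuousLinearMap.le_opNorm _ _
        _ ≤ 1 * ‖ψ‖ := mul_le_mul_of_nonneg_right hP (norm_nonneg _)
        _ = ‖ψ‖ := one_mul _
  | insert p S _ ih =>
    obtain ⟨g, h1, h2, h3, h4⟩ := ih
    exact rect_symmetrization_step ρ J hρ hz hzz _ p.1 p.2 S _ ψ g h1 h2 h3 h4

/-- **INSIDE A FLUX SECTOR OF A RECTANGULAR TUBE, `T` ONLY SEES JOINTLY ODD FUNCTIONS.**  For every flux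
`e ∈ ℤ₂^k` and `ψ ∈ L²(slice)` there is `g ∈ L²(slice)` with `T g = T (P_e ψ)`, `‖g‖ ≤ ‖ψ‖`, and `g ∘ σ_{μ,s} = −g`
a.e. for EVERY direction `μ` with `e_μ = 1` and EVERY hyperplane `x_μ = s`, `s ∈ ℤ/(Ls μ)` (continuous `ρ`, central
involution `z`). [cite: tHooft1979Flux] [cite: Luscher1977] -/
theorem exists_jointlyOdd_of_rectFluxProjection (hρ : Continuous ρ) {z : G} (hz : z ∈ Subgroup.center G)
    (hzz : z * z = 1) (e : Fin k → ZMod 2) (ψ : Lp ℝ 2 (rectSliceMeasure G Ls)) :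
    ∃ g : Lp ℝ 2 (rectSliceMeasure G Ls),
      rectTubeTransferOperator ρ J Ls g = rectTubeTransferOperator ρ J Ls (rectTubeFluxProjection z Ls e ψ) ∧
      ‖g‖ ≤ ‖ψ‖ ∧
      ∀ μ : Fin k, e μ = 1 → ∀ s : ZMod (Ls μ), ∀ᵐ b ∂(rectSliceMeasure G Ls),
        (g : RectSlice Ls G → ℝ) (fun e' => (if e'.2 = μ ∧ e'.1 μ = s then z else 1) * b e') =
          -(g : RectSlice Ls G → ℝ) b := by
  classical
  obtain ⟨g, hodd, hinv, hT, hnorm⟩ := exists_rectSymmetrized ρ J hρ hz hzz e ψ Finset.univ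
  refine ⟨g, hT, hnorm, fun μ hμ => ?_⟩
  have hodd0 := hodd μ (Finset.mem_filter.2 ⟨Finset.mem_univ μ, hμ⟩)
  -- induction along the layers: `σ_{μ,t}` from `σ_{μ,t-1}` and `η_{μ,t}`
  have key : ∀ j : ℕ, ∀ᵐ b ∂(rectSliceMeasure G Ls),
      (g : RectSlice Ls G → ℝ) (fun e' => (if e'.2 = μ ∧ e'.1 μ = (j : ZMod (Ls μ)) then z else 1) * b e') =
        -(g : RectSlice Ls G → ℝ) b := by
    intro j
    induction j with
    | zero => simpa only [Nat.cast_zero] using hodd0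
    | succ j ih =>
      set t : ZMod (Ls μ) := ((j + 1 : ℕ) : ZMod (Ls μ)) with ht
      have htj : t - 1 = (j : ZMod (Ls μ)) := by rw [ht, Nat.cast_succ, add_sub_cancel_right]
      have hmpσ : MeasurePreserving
          (fun (b : RectSlice Ls G) (e' : RectTorusSite Ls × Fin k) =>
            (if e'.2 = μ ∧ e'.1 μ = t - 1 then z else 1) * b e')
          (rectSliceMeasure G Ls) (rectSliceMeasure G Ls) :=
        measurePreserving_rectHyperplaneFlip z μ (t - 1)
      have h1 := hmpσ.quasiMeasurePreserving.ae (hinv ⟨μ, t⟩ (Finset.mem_univ _))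
      filter_upwards [h1, ih] with b hb1 hb2
      rw [rectGauge_layer_hyperplaneFlip hz hzz μ t b] at hb1
      rw [hb1, htj]
      exact hb2
  intro s
  have hs : s = ((s.val : ℕ) : ZMod (Ls μ)) := (ZMod.natCast_zmod_val s).symm
  rw [hs]
  exact key s.val

/-- The axial case: inside the sector `ê_μ` of a rectangular tube, `T` only sees functions odd under every
hyperplane flip along `μ`. [cite: tHooft1979Flux] -/
theorem exists_jointlyOdd_of_rectFluxProjection_single (hρ : Continuous ρ) {z : G} (hz : z ∈ Subgroup.center G)
    (hzz : z * z = 1) (μ : Fin k) (ψ : Lp ℝ 2 (rectSliceMeasure G Ls)) :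
    ∃ g : Lp ℝ 2 (rectSliceMeasure G Ls),
      rectTubeTransferOperator ρ J Ls g =
        rectTubeTransferOperator ρ J Ls (rectTubeFluxProjection z Ls (Pi.single μ 1) ψ) ∧
      ‖g‖ ≤ ‖ψ‖ ∧
      ∀ s : ZMod (Ls μ), ∀ᵐ b ∂(rectSliceMeasure G Ls),
        (g : RectSlice Ls G → ℝ) (fun e' => (if e'.2 = μ ∧ e'.1 μ = s then z else 1) * b e') =
          -(g : RectSlice Ls G → ℝ) b := by
  obtain ⟨g, hT, hnorm, hodd⟩ := exists_jointlyOdd_of_rectFluxProjection ρ J hρ hz hzz (Pi.single μ 1) ψ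
  exact ⟨g, hT, hnorm, hodd μ (by simp)⟩

end Symmetrization

end Summit.Ventures.YMGap.FlowData
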